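import Summits.Ventures.YMGap.RobustBall.HeatBathPoincare
import Summits.Ventures.YMGap.RobustBall.BoundaryDecayKR
import Summits.Ventures.YMGap.RobustBall.ZdAxisProfile
import Summits.Ventures.YMGap.SlabAreaLawDimensions
import Literature.Probability.LatticeModels.GibbsStrongMarkov
import HarnessLib

/-!
# Robust ball (Y2) — THE HEAT-BATH POINCARÉ INEQUALITY ON `ℤ^d`: FINITE VOLUMES UNIFORMLY IN THE BOUNDARY FIELD,
# AND EVERY INFINITE-VOLUME GIBBS STATE, on the Kantorovich–Rubinstein window of the one-link modulus

HONEST FRAMING: venture file of the cell `pub-ymgap` (QuantumFields programme), track ROBUST-BALL, seat rb-p2 (g12).  LATTICE statements at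
strong coupling; nothing here concerns the continuum limit or the Clay problem.  The `ℤ^d` companion of `HeatBathPoincare.lean` (tori):
* `kernelVariance_le_of_oneLinkKRModulus` — for the Wilson specification `γ` of `SU(N)` lattice Yang–Mills on `ℤ^d` at 't Hooft coupling `β`
  (bare coupling `N β`), a one-link Kantorovich–Rubinstein modulus `OneLinkKRModulus N R K` on `‖B‖_op ≤ R`, `2(d−1)|β| ≤ R`, and the Dobrushin
  column sum `6(d−1)|β|K ≤ c < 1`: for EVERY finite link volume `V`, EVERY boundary field `η` and every bounded measurable `F`,
  `Var_{γ_V(·|η)}(F) ≤ (2(1−c))⁻¹ ∑_{x ∈ V} ∫ (∫ (F(U) − F(σ))² γ_{x}(dσ|U)) γ_V(dU|η)` — the single-link heat-bath (Glauber) dynamics of the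
  finite volume with boundary condition `η` has spectral gap `≥ 1 − c`, UNIFORMLY IN `V` AND `η` (engine: the YangMills summit's
  `StrongPinningPoincare.HeatBath.variance_le_of_kr`, transported through `glueWith`).
* `su2_kernelVariance_le` — `SU(2)`, `d = 4`, HYPOTHESIS-FREE on `0 ≤ β_W < 2/9` (tree coupling `β_W/2`, quarter modulus), constant `(2 − 9β_W)⁻¹`.
* tools: the influence count `linkInfluence` is symmetric off the diagonal (`linkInfluence_comm`, so its COLUMN sums are `≤ 6(d−1)`,
  `sum_linkInfluence_col_le`); inside a volume the one-link tilt of `γ_V` is the one-link law of the specification (`tilted_update_eq_siteLaw`,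
  't Hooft form `tilted_update_eq_thooft`); the conditional-variance functional `U ↦ ∫ (F(U) − F(σ))² γ_{x}(dσ|U)` is measurable and `≤ 4M²`
  (`measurable_integral_sq_sub`, `abs_integral_sq_sub_le`) — the inputs of the DLR (infinite-volume) version, which is the companion file's business.
References: L. Wu, Ann. Inst. Fourier 56 (2006) (Poincaré from Dobrushin's condition); H. Föllmer, LNM 1362 (1988) Ch. I; H.-O. Georgii (2011)
Rem. 1.24, Thm. 8.20; H. Shen, R. Zhu, X. Zhu, CMP 400 (2023) §4 (the Langevin analogue at `β_W < 1/12`).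
-/

noncomputable section

open MeasureTheory Function Real Filter Finset ProbabilityTheory
open scoped ENNReal NNReal
open Literature.Probability.LatticeModels
open Literature.Probability.LatticeModels.DobrushinMetric
open Literature.MathematicalPhysics.QuantumLattice
open Literature.MathematicalPhysics.QuantumFieldTheory hiding ZdEdge
open Literature.MathematicalPhysics.QuantumFieldTheory.Balaban1983to89.StrongCouplingDobrushinWindow (OneLinkKRModulus)
open Summit.QuantumFields.YangMills.Theorems.StrongPinningPoincare

namespace Summit.Ventures.YMGap.RobustBall.HeatBathPoincareZd

variable {d N : ℕ}

/-! ### `ℤ^d` combinatorics: the influence count is symmetric off the diagonal, so its column sums are `≤ 6(d−1)` -/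

section Combinatorics

/-- Per plaquette: for `y ≠ x ∈ p`, exactly one staple link of `p` at `x` equals `y` iff `y ∈ p`. [folklore] -/
theorem sum_ite_stapleLinks_eq (p : ZdPlaquette d) {x y : ZdEdge d} (hx : x ∈ plaquetteEdges p) (hxy : y ≠ x) :
    (∑ k : Fin 3, if stapleLinks p x k = y then (1 : ℕ) else 0) = if y ∈ plaquetteEdges p then 1 else 0 := by
  have h := ZdAxis.sum_stapleLinks_eq p hx (fun e => if e = y then (1 : ℝ) else 0)
  have hx0 : (if x = y then (1 : ℝ) else 0) = 0 := if_neg (Ne.symm hxy)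
  have h4 : (if plaqLink1 p = y then (1 : ℝ) else 0) + (if plaqLink2 p = y then (1 : ℝ) else 0) +
      (if plaqLink3 p = y then (1 : ℝ) else 0) + (if plaqLink4 p = y then (1 : ℝ) else 0) =
      ∑ e ∈ plaquetteEdges p, (if e = y then (1 : ℝ) else 0) := by
    rw [plaquetteEdges_eq, Finset.sum_insert (by simp [plaqLink1_ne_plaqLink2, plaqLink1_ne_plaqLink3, plaqLink1_ne_plaqLink4]),
      Finset.sum_insert (by simp [plaqLink2_ne_plaqLink3, plaqLink2_ne_plaqLink4]),
      Finset.sum_insert (by simp [plaqLink3_ne_plaqLink4]), Finset.sum_singleton]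
    ring
  have h5 : ∑ e ∈ plaquetteEdges p, (if e = y then (1 : ℝ) else 0) = if y ∈ plaquetteEdges p then 1 else 0 := by
    rw [Finset.sum_ite_eq' (plaquetteEdges p) y (fun _ => (1 : ℝ))]
  rw [hx0, sub_zero, h4, h5] at h
  have h' : ((∑ k : Fin 3, if stapleLinks p x k = y then (1 : ℕ) else 0 : ℕ) : ℝ) = ((if y ∈ plaquetteEdges p then 1 else 0 : ℕ) : ℝ) := by
    push_cast
    exact h
  exact_mod_cast h'

/-- **Off the diagonal the influence count is the number of common plaquettes**: `n(x, y) = #{p ∋ x : y ∈ p}` for `y ≠ x`. [folklore] -/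
theorem linkInfluence_eq_card {x y : ZdEdge d} (hxy : y ≠ x) :
    linkInfluence x y = ((plaquettesTouching {x}).filter fun p => y ∈ plaquetteEdges p).card := by
  unfold linkInfluence
  rw [Finset.card_eq_sum_ones, Finset.sum_filter]
  exact Finset.sum_congr rfl fun p hp => sum_ite_stapleLinks_eq p (mem_plaquettesTouching_singleton.1 hp) hxy

/-- **The influence count is symmetric off the diagonal**: `n(x, y) = n(y, x)` for `x ≠ y`. [folklore] -/
theorem linkInfluence_comm {x y : ZdEdge d} (hxy : x ≠ y) : linkInfluence x y = linkInfluence y x := by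
  rw [linkInfluence_eq_card (Ne.symm hxy), linkInfluence_eq_card hxy]
  congr 1
  ext p
  simp only [Finset.mem_filter, mem_plaquettesTouching_singleton]
  exact and_comm

/-- Off the plaquette neighbourhood (and off the diagonal) the influence count vanishes. [folklore] -/
theorem linkInfluence_eq_zero {x y : ZdEdge d} (hxy : y ≠ x) (hy : y ∉ linkPlaqNbr x) :
    linkInfluence x y = 0 := by
  rw [linkInfluence_eq_card hxy, Finset.card_eq_zero, Finset.filter_eq_empty_iff]
  intro p hp hyp
  exact hy (mem_linkPlaqNbr_iff.2 ⟨hxy, p, mem_plaquettesTouching_singleton.1 hp, hyp⟩)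

/-- Row sums over any set of links avoiding `x`: `∑_{y ∈ T} n(x, y) ≤ 6(d−1)`. [folklore] -/
theorem sum_linkInfluence_le_of_not_mem (x : ZdEdge d) {T : Finset (ZdEdge d)} (hx : x ∉ T) :
    ∑ y ∈ T, linkInfluence x y ≤ 6 * (d - 1) := by
  have h1 : ∑ y ∈ T, linkInfluence x y = ∑ y ∈ T.filter (· ∈ linkPlaqNbr x), linkInfluence x y := by
    rw [Finset.sum_filter]
    refine Finset.sum_congr rfl fun y hy => ?_
    split_ifs with h
    · rfl
    · exact linkInfluence_eq_zero (fun h' => hx (h' ▸ hy)) h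
  rw [h1]
  exact (Finset.sum_le_sum_of_subset (fun y hy => (Finset.mem_filter.1 hy).2)).trans (sum_linkInfluence_le x)

/-- **COLUMN SUMS OF THE INFLUENCE COUNT**: `∑_{x ∈ T} n(x, y) ≤ 6(d−1)` for every finite `T ∌ y`. [folklore] -/
theorem sum_linkInfluence_col_le (y : ZdEdge d) {T : Finset (ZdEdge d)} (hy : y ∉ T) :
    ∑ x ∈ T, linkInfluence x y ≤ 6 * (d - 1) := by
  rw [Finset.sum_congr rfl fun x (hx : x ∈ T) => linkInfluence_comm (fun h : x = y => hy (h ▸ hx))]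
  exact sum_linkInfluence_le_of_not_mem y hy

end Combinatorics

/-! ### Gluing and one-link updates -/

section Glue

variable {G : Type*}

/-- Updating a glued configuration at an inner link is gluing the updated inner configuration. [folklore] -/
theorem glueWith_update (V : Finset (ZdEdge d)) (η : LGConfig d G) (ζ : ↥V → G) (i : ↥V) (g : G) :
    glueWith V (update ζ i g) η = update (glueWith V ζ η) i.1 g := by
  funext z
  by_cases hz : z = i.1
  · subst hz
    rw [update_self, glueWith_apply_mem _ _ _ i.2, update_self]
  · rw [update_of_ne hz]
    by_cases hzV : z ∈ V
    · rw [glueWith_apply_mem _ _ _ hzV, glueWith_apply_mem _ _ _ hzV, update_of_ne]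
      exact fun h => hz (congrArg Subtype.val h)
    · rw [glueWith_apply_not_mem _ _ _ hzV, glueWith_apply_not_mem _ _ _ hzV]

end Glue

/-! ### The one-link conditional law inside a finite volume is the one-link heat bath -/

section OneLink

variable {G : Type*} [Group G] (ρ : G →* Matrix (Fin N) (Fin N) ℂ)

/-- **The Wilson action of `V` is the one-link action plus a term not reading the link**: for `x ∈ V`,
`S_V(U[x ↦ g]) = S_{x}(U[x ↦ g]) + ∑_{p ∩ V ≠ ∅, x ∉ p} (N − Re tr ρ(U_p))`. [folklore] -/
theorem wilsonBoundaryAction_update_eq {V : Finset (ZdEdge d)} {x : ZdEdge d} (hx : x ∈ V)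
    (U : LGConfig d G) (g : G) :
    wilsonBoundaryAction ρ V (update U x g) = wilsonBoundaryAction ρ {x} (update U x g) +
      ∑ p ∈ plaquettesTouching V \ plaquettesTouching {x}, ((N : ℝ) - plaquetteObs ρ p.1 p.2.1.1 p.2.1.2 U) := by
  have hsub : plaquettesTouching {x} ⊆ plaquettesTouching V := fun p hp =>
    mem_plaquettesTouching_iff.2 ⟨x, Finset.mem_inter.2 ⟨mem_plaquettesTouching_singleton.1 hp, hx⟩⟩
  unfold wilsonBoundaryAction
  rw [← Finset.sum_sdiff hsub, add_comm]
  congr 1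
  refine Finset.sum_congr rfl fun p hp => ?_
  have hxp : x ∉ plaquetteEdges p := fun h => (Finset.mem_sdiff.1 hp).2 (mem_plaquettesTouching_singleton.2 h)
  have hdep : ∀ e ∈ (↑(plaquetteEdges p) : Set (ZdEdge d)), update U x g e = U e := fun e he =>
    update_of_ne (fun h : e = x => hxp (h ▸ Finset.mem_coe.1 he)) _ _
  rw [isCylinder_plaquetteObs ρ p hdep]

end OneLink

/-! ### `SU(N)`: the one-link heat bath of a finite volume, and the conditional-variance functional -/

section SUN

/-- **Inside the volume, the one-link tilt of `γ_V` is the one-link law of the specification**: for `x ∈ V`,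
`Haar.tilted(−β' S_V(U[x ↦ ·])) = γ_{x}(σ_x ∈ · | U)` (the plaquettes of `V` not through `x` tilt by a constant). [folklore] -/
theorem tilted_update_eq_siteLaw (β' : ℝ) {V : Finset (ZdEdge d)} {x : ZdEdge d} (hx : x ∈ V)
    (U : LGConfig d (Matrix.specialUnitaryGroup (Fin N) ℂ)) :
    (haarProbability (Matrix.specialUnitaryGroup (Fin N) ℂ)).tilted
        (fun g => -β' * wilsonBoundaryAction (fundamentalRep (Fin N)) V (update U x g)) =
      siteLaw (ymSpecification (fundamentalRep (Fin N)) β') x U := by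
  haveI : SecondCountableTopology (Matrix (Fin N) (Fin N) ℂ) :=
    inferInstanceAs (SecondCountableTopology (Fin N → Fin N → ℂ))
  haveI : SecondCountableTopology (Matrix.specialUnitaryGroup (Fin N) ℂ) :=
    Topology.IsEmbedding.subtypeVal.secondCountableTopology
  rw [siteLaw_ymSpecification_eq_tilted_haar _ (continuous_fundamentalRep (Fin N))]
  set C : ℝ := ∑ p ∈ plaquettesTouching V \ plaquettesTouching {x},
    ((N : ℝ) - plaquetteObs (fundamentalRep (Fin N)) p.1 p.2.1.1 p.2.1.2 U) with hC
  have h1 : (fun g : Matrix.specialUnitaryGroup (Fin N) ℂ =>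
      -β' * wilsonBoundaryAction (fundamentalRep (Fin N)) V (update U x g)) =
      fun g => -β' * C + -β' * wilsonBoundaryAction (fundamentalRep (Fin N)) {x} (update U x g) := by
    funext g
    rw [wilsonBoundaryAction_update_eq _ hx]
    ring
  rw [h1, tilted_const_add_eq]

/-- **The one-link heat bath in 't Hooft form inside the volume**: for `x ∈ V`, at bare coupling `N β`,
`Haar.tilted(−Nβ S_V(U[x ↦ ·])) = Haar.tilted(N Re tr(· B_U))`, `B_U = β ∑_{p ∋ x}` staples. [folklore] -/
theorem tilted_update_eq_thooft (β : ℝ) {V : Finset (ZdEdge d)} {x : ZdEdge d} (hx : x ∈ V)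
    (U : LGConfig d (Matrix.specialUnitaryGroup (Fin N) ℂ)) :
    (haarProbability (Matrix.specialUnitaryGroup (Fin N) ℂ)).tilted
        (fun g => -((N : ℝ) * β) * wilsonBoundaryAction (fundamentalRep (Fin N)) V (update U x g)) =
      (haarProbability (Matrix.specialUnitaryGroup (Fin N) ℂ)).tilted
        fun g => (N : ℝ) * ((g : Matrix (Fin N) (Fin N) ℂ) * stapleField β x U).trace.re := by
  rw [tilted_update_eq_siteLaw _ hx, siteLaw_ymSpecification_thooft]

variable {S : Type*} [MeasurableSpace S] {ι : Type*}

/-- **The conditional-variance functional, expanded**: for a specification `γ`, a bounded measurable `F` and a site `x`,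
`∫ (F(η) − F(σ))² γ_{x}(dσ|η) = F(η)² − 2 F(η) (T_x F)(η) + (T_x F²)(η)`. [folklore] -/
theorem integral_sq_sub_eq {γ : Specification ι S} (hγ : IsSpecification γ) (x : ι) {F : (ι → S) → ℝ} (hF : Measurable F)
    {M : ℝ} (hM : ∀ σ, |F σ| ≤ M) (η : ι → S) :
    ∫ σ, (F η - F σ) ^ 2 ∂(γ {x} η) = F η ^ 2 - 2 * F η * siteAvg γ x F η + siteAvg γ x (fun σ => F σ ^ 2) η := by
  haveI := hγ.isProbability {x} η
  have hi : Integrable F (γ {x} η) := integrable_of_abs_le' hF hM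
  have hi2 : Integrable (fun σ => F σ ^ 2) (γ {x} η) :=
    integrable_of_abs_le' (hF.pow_const 2) (M := M ^ 2) fun σ => by
      rw [abs_pow]; exact pow_le_pow_left₀ (abs_nonneg _) (hM σ) 2
  have h1 : (fun σ => (F η - F σ) ^ 2) = fun σ => (F η ^ 2 - 2 * F η * F σ) + F σ ^ 2 := by
    funext σ; ring
  have hA : ∫ σ, F η ^ 2 - 2 * F η * F σ + F σ ^ 2 ∂γ {x} η =
      (∫ σ, F η ^ 2 - 2 * F η * F σ ∂γ {x} η) + ∫ σ, F σ ^ 2 ∂γ {x} η :=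
    integral_add ((integrable_const _).sub (hi.const_mul _)) hi2
  have hB : ∫ σ, F η ^ 2 - 2 * F η * F σ ∂γ {x} η = (∫ _σ, F η ^ 2 ∂γ {x} η) - ∫ σ, 2 * F η * F σ ∂γ {x} η :=
    integral_sub (integrable_const _) (hi.const_mul _)
  have hC : ∫ σ, 2 * F η * F σ ∂γ {x} η = 2 * F η * ∫ σ, F σ ∂γ {x} η := integral_const_mul _ _
  have hD : ∫ _σ, F η ^ 2 ∂γ {x} η = F η ^ 2 := by simp
  unfold siteAvg
  rw [h1, hA, hB, hC, hD]

/-- The conditional-variance functional is measurable. [folklore] -/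
theorem measurable_integral_sq_sub {γ : Specification ι S} (hγ : IsSpecification γ) (x : ι) {F : (ι → S) → ℝ}
    (hF : Measurable F) {M : ℝ} (hM : ∀ σ, |F σ| ≤ M) :
    Measurable fun η => ∫ σ, (F η - F σ) ^ 2 ∂(γ {x} η) := by
  have h : (fun η => ∫ σ, (F η - F σ) ^ 2 ∂(γ {x} η)) =
      fun η => F η ^ 2 - 2 * F η * siteAvg γ x F η + siteAvg γ x (fun σ => F σ ^ 2) η :=
    funext (integral_sq_sub_eq hγ x hF hM)
  rw [h]
  exact (((hF.pow_const 2).sub ((measurable_const.mul hF).mul (measurable_siteAvg hγ x hF))).add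
    (measurable_siteAvg hγ x (hF.pow_const 2)))

/-- The conditional-variance functional is bounded by `4M²` (and non-negative). [folklore] -/
theorem abs_integral_sq_sub_le {γ : Specification ι S} (hγ : IsSpecification γ) (x : ι) {F : (ι → S) → ℝ}
    {M : ℝ} (hM : ∀ σ, |F σ| ≤ M) (η : ι → S) :
    |∫ σ, (F η - F σ) ^ 2 ∂(γ {x} η)| ≤ 4 * M ^ 2 := by
  haveI := hγ.isProbability {x} η
  rw [abs_of_nonneg (integral_nonneg fun σ => sq_nonneg _)]
  have hb : ∀ σ, (F η - F σ) ^ 2 ≤ 4 * M ^ 2 := fun σ => by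
    have h1 : |F η - F σ| ≤ 2 * M := (abs_sub _ _).trans (by linarith [hM η, hM σ])
    have h2 : (F η - F σ) ^ 2 = |F η - F σ| ^ 2 := (sq_abs _).symm
    rw [h2]
    nlinarith [abs_nonneg (F η - F σ)]
  have h := integral_mono_of_nonneg (μ := γ {x} η) (ae_of_all _ fun σ => sq_nonneg (F η - F σ)) (integrable_const (4 * M ^ 2))
    (ae_of_all _ hb)
  simpa using h

end SUN

/-! ### The kernel Poincaré inequality, uniformly in the volume and in the boundary field -/

section Kernel

/-- ★★ **THE HEAT-BATH POINCARÉ INEQUALITY OF A FINITE VOLUME WITH BOUNDARY CONDITION, UNIFORMLY IN BOTH** (`SU(N)` lattice Yang–Mills on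
`ℤ^d`, bare coupling `N β`).  If `2(d−1)|β| ≤ R`, `OneLinkKRModulus N R K` (`K ≥ 0`) and `6(d−1)|β| K ≤ c < 1`, then for every non-empty finite
link volume `V`, every boundary field `η` and every bounded measurable `F`:
`Var_{γ_V(·|η)}(F) ≤ (2(1−c))⁻¹ ∑_{x ∈ V} ∫ (∫ (F(U) − F(σ))² γ_{x}(dσ|U)) γ_V(dU|η)` — the random-scan single-link heat-bath dynamics of the
volume `V` with boundary condition `η` has spectral gap `≥ 1 − c` (Wu 2006; engine `StrongPinningPoincare.HeatBath.variance_le_of_kr`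
transported through `glueWith`). [folklore] -/
theorem kernelVariance_le_of_oneLinkKRModulus (hd : 1 ≤ d) (hN : 1 ≤ N) {β R K c : ℝ} (hK : 0 ≤ K)
    (hR : |β| * (2 * ((d : ℝ) - 1)) ≤ R) (hmod : OneLinkKRModulus N R K) (hc : 6 * ((d : ℝ) - 1) * |β| * K ≤ c) (hc1 : c < 1)
    {V : Finset (ZdEdge d)} (hV : V.Nonempty) (η : LGConfig d (Matrix.specialUnitaryGroup (Fin N) ℂ))
    {F : LGConfig d (Matrix.specialUnitaryGroup (Fin N) ℂ) → ℝ} (hF : Measurable F) (hFb : ∃ M : ℝ, ∀ U, |F U| ≤ M) :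
    ProbabilityTheory.variance F (ymSpecification (fundamentalRep (Fin N)) (N * β) V η) ≤
      (2 * (1 - c))⁻¹ * ∑ x ∈ V, ∫ U, ∫ σ, (F U - F σ) ^ 2 ∂(ymSpecification (fundamentalRep (Fin N)) (N * β) {x} U)
        ∂(ymSpecification (fundamentalRep (Fin N)) (N * β) V η) := by
  haveI : SecondCountableTopology (Matrix (Fin N) (Fin N) ℂ) :=
    inferInstanceAs (SecondCountableTopology (Fin N → Fin N → ℂ))
  haveI : SecondCountableTopology (Matrix.specialUnitaryGroup (Fin N) ℂ) :=
    Topology.IsEmbedding.subtypeVal.secondCountableTopology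
  haveI : Nonempty (Fin N) := ⟨⟨0, hN⟩⟩
  haveI : Nonempty ↥V := hV.coe_sort
  obtain ⟨M, hM⟩ := hFb
  have hρc := continuous_fundamentalRep (Fin N)
  set γ := ymSpecification (d := d) (fundamentalRep (Fin N)) (N * β) with hγdef
  have hγ : IsSpecification γ := isSpecification_ymSpecification_of_t2Space _ hρc _
  -- the product space over the volume and the gluing map
  set lam := haarProbability (Matrix.specialUnitaryGroup (Fin N) ℂ) with hlam
  set glue : (↥V → Matrix.specialUnitaryGroup (Fin N) ℂ) → LGConfig d (Matrix.specialUnitaryGroup (Fin N) ℂ) :=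
    fun ζ => glueWith V ζ η with hglue
  have hgm : Measurable glue := measurable_glueWith V η
  set W : LGConfig d (Matrix.specialUnitaryGroup (Fin N) ℂ) → ℝ :=
    fun U => -((N : ℝ) * β) * wilsonBoundaryAction (fundamentalRep (Fin N)) V U with hW
  have hWc : Continuous W := continuous_const.mul (continuous_wilsonBoundaryAction _ hρc V)
  obtain ⟨B, hB⟩ := exists_bound_of_continuous hWc
  have hVm : Measurable (W ∘ glue) := hWc.measurable.comp hgm
  have hVb : ∀ x, |(W ∘ glue) x| ≤ B := fun x => hB _
  -- the kernel is the glued tilted product measure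
  have hker : γ V η = ((Measure.pi fun _ : ↥V => lam).tilted (W ∘ glue)).map glue := by
    rw [map_tilted_comp _ hgm hWc.measurable]
    rfl
  -- the Frobenius distance on `SU(N)`
  have hdc : Continuous fun p : Matrix.specialUnitaryGroup (Fin N) ℂ × Matrix.specialUnitaryGroup (Fin N) ℂ => suFrobDist p.1 p.2 :=
    Lattice.continuous_frobNorm.comp ((continuous_subtype_val.comp continuous_fst).sub (continuous_subtype_val.comp continuous_snd))
  have hd0 : ∀ e : Matrix.specialUnitaryGroup (Fin N) ℂ, suFrobDist e e = 0 := suFrobDist_self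
  have hdsep : ∀ e e' : Matrix.specialUnitaryGroup (Fin N) ℂ, suFrobDist e e' = 0 → e = e' := fun e e' h =>
    Subtype.ext (sub_eq_zero.1 (Lattice.eq_zero_of_frobNorm_eq_zero h))
  have hdtri : ∀ a b c' : Matrix.specialUnitaryGroup (Fin N) ℂ, suFrobDist a c' ≤ suFrobDist a b + suFrobDist b c' :=
    fun a b c' => frobNorm_sub_le _ _ _
  -- the interaction matrix and its column sums
  set cm : ↥V → ↥V → ℝ := fun i j => K * |β| * linkInfluence i.1 j.1 with hcm
  have hκ₀ : 0 < 1 - c := by linarith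
  have hdd : (0 : ℝ) ≤ (d : ℝ) - 1 := by
    have : (1 : ℝ) ≤ d := by exact_mod_cast hd
    linarith
  have hcnn : 0 ≤ c := le_trans (mul_nonneg (mul_nonneg (mul_nonneg (by norm_num) hdd) (abs_nonneg β)) hK) hc
  have hd1 : ((6 * (d - 1) : ℕ) : ℝ) = 6 * ((d : ℝ) - 1) := by push_cast [Nat.cast_sub hd]; ring
  have hcsum : ∀ j, ∑ i ∈ Finset.univ.erase j, cm i j ≤ 1 - (1 - c) := fun j => by
    simp only [hcm]
    rw [← Finset.mul_sum, sub_sub_cancel]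
    have h1 : ∑ i ∈ Finset.univ.erase j, (linkInfluence i.1 j.1 : ℝ) = ∑ x ∈ V.erase j.1, (linkInfluence x j.1 : ℝ) := by
      rw [Finset.sum_erase_eq_sub (Finset.mem_univ j), Finset.sum_erase_eq_sub j.2,
        Finset.sum_coe_sort V (fun x => (linkInfluence x j.1 : ℝ))]
    have h2 : ∑ x ∈ V.erase j.1, (linkInfluence x j.1 : ℝ) ≤ 6 * ((d : ℝ) - 1) := by
      rw [← hd1]
      exact_mod_cast sum_linkInfluence_col_le j.1 (Finset.notMem_erase j.1 V)
    rw [h1]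
    calc K * |β| * ∑ x ∈ V.erase j.1, (linkInfluence x j.1 : ℝ) ≤ K * |β| * (6 * ((d : ℝ) - 1)) :=
          mul_le_mul_of_nonneg_left h2 (by positivity)
      _ = 6 * ((d : ℝ) - 1) * |β| * K := by ring
      _ ≤ c := hc
  -- one-link updates through the gluing
  have hup : ∀ (x : ↥V → Matrix.specialUnitaryGroup (Fin N) ℂ) (i : ↥V) (e : Matrix.specialUnitaryGroup (Fin N) ℂ),
      glue (update x i e) = update (glue x) i.1 e := fun x i e => glueWith_update V η x i e
  have htilt : ∀ (x : ↥V → Matrix.specialUnitaryGroup (Fin N) ℂ) (i : ↥V),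
      lam.tilted (fun e => (W ∘ glue) (update x i e)) =
        lam.tilted (fun g => (N : ℝ) * ((g : Matrix (Fin N) (Fin N) ℂ) * stapleField β i.1 (glue x)).trace.re) := fun x i => by
    have h1 : (fun e => (W ∘ glue) (update x i e)) =
        fun g => -((N : ℝ) * β) * wilsonBoundaryAction (fundamentalRep (Fin N)) V (update (glue x) i.1 g) := by
      funext e; simp only [Function.comp, hW, hup]
    rw [h1, tilted_update_eq_thooft β i.2]
  -- the one-site Kantorovich–Rubinstein condition from the modulus
  have hKR : ∀ (i j : ↥V), i ≠ j → ∀ (x : ↥V → Matrix.specialUnitaryGroup (Fin N) ℂ)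
      (a : Matrix.specialUnitaryGroup (Fin N) ℂ) (ψ : Matrix.specialUnitaryGroup (Fin N) ℂ → ℝ) (Lψ Mψ : ℝ), Measurable ψ →
      (∀ e, |ψ e| ≤ Mψ) → 0 ≤ Lψ → (∀ e e', |ψ e - ψ e'| ≤ Lψ * suFrobDist e e') →
      |∫ e, ψ e ∂(lam.tilted fun e => (W ∘ glue) (update x i e)) -
        ∫ e, ψ e ∂(lam.tilted fun e => (W ∘ glue) (update (update x j a) i e))| ≤ Lψ * cm i j * suFrobDist (x j) a := by
    intro i j hij x a ψ Lψ Mψ hψm hψb hL0 hψL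
    rw [htilt x i, htilt (update x j a) i]
    have hB1 : matrixOpNorm (stapleField β i.1 (glue x)) ≤ R := (matrixOpNorm_stapleField_le hd hN β i.1 _).trans hR
    have hB2 : matrixOpNorm (stapleField β i.1 (glue (update x j a))) ≤ R := (matrixOpNorm_stapleField_le hd hN β i.1 _).trans hR
    have key := hmod _ _ hB1 hB2 ψ Lψ hψm ⟨Mψ, hψb⟩ hL0 hψL
    have hja : glue (update x j a) j.1 = a := by rw [hup, update_self]
    have hjx : glue x j.1 = x j := by
      show glueWith V x η j.1 = x j
      rw [glueWith_apply_mem _ _ _ j.2]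
    have hdiff : frobNorm (stapleField β i.1 (glue x) - stapleField β i.1 (glue (update x j a))) ≤
        |β| * linkInfluence i.1 j.1 * suFrobDist (x j) a := by
      have h := frobNorm_stapleField_sub_le (N := N) β i.1 j.1 (ω := glue x) (η := glue (update x j a))
        (fun z hz => by rw [hup, update_of_ne hz])
      rwa [hja, hjx] at h
    have hd0' : 0 ≤ suFrobDist (x j) a := suFrobDist_nonneg _ _
    calc _ ≤ K * Lψ * frobNorm (stapleField β i.1 (glue x) - stapleField β i.1 (glue (update x j a))) := key
      _ ≤ K * Lψ * (|β| * linkInfluence i.1 j.1 * suFrobDist (x j) a) := mul_le_mul_of_nonneg_left hdiff (mul_nonneg hK hL0)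
      _ = Lψ * cm i j * suFrobDist (x j) a := by simp only [hcm]; ring
  -- the abstract theorem on the product space
  have key := HeatBath.variance_le_of_kr (ι := ↥V) lam hVm hVb suFrobDist hdc hd0 suFrobDist_nonneg suFrobDist_comm hdtri hdsep
    suFrobDist_le cm hκ₀ (by linarith) hcsum hKR (hF.comp hgm) (fun x => hM (glue x))
  -- back to the volume: left-hand side
  rw [hker, ProbabilityTheory.variance_map hF.aemeasurable hgm.aemeasurable]
  refine key.trans (le_of_eq ?_)
  congr 1
  rw [← Finset.sum_coe_sort V]
  refine Finset.sum_congr rfl fun i _ => ?_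
  -- right-hand side, link by link
  have hh : ∀ x : ↥V → Matrix.specialUnitaryGroup (Fin N) ℂ,
      ∫ e, ((F ∘ glue) x - (F ∘ glue) (update x i e)) ^ 2 ∂(lam.tilted fun e => (W ∘ glue) (update x i e)) =
        ∫ σ, (F (glue x) - F σ) ^ 2 ∂(γ {i.1} (glue x)) := fun x => by
    have h1 : (fun e => (W ∘ glue) (update x i e)) =
        fun g => -((N : ℝ) * β) * wilsonBoundaryAction (fundamentalRep (Fin N)) V (update (glue x) i.1 g) := by
      funext e; simp only [Function.comp, hW, hup]
    rw [h1, tilted_update_eq_siteLaw _ i.2]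
    have h2 := siteAvg_eq_integral_siteLaw hγ i.1 (f := fun σ => (F (glue x) - F σ) ^ 2) (measurable_const.sub hF |>.pow_const 2) (glue x)
    unfold siteAvg at h2
    beta_reduce at h2
    rw [h2]
    simp only [Function.comp, hup]
    rfl
  simp_rw [hh]
  exact (integral_map hgm.aemeasurable (measurable_integral_sq_sub hγ i.1 hF hM).aestronglyMeasurable).symm

/-- ★★ **`SU(2)`, `d = 4`, HYPOTHESIS-FREE on `0 ≤ β_W < 2/9`** (tree coupling `β_W/2`, quarter modulus `OneLinkKRModulus 2 R 1`, `R ≤ 1`): for every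
non-empty finite link volume `V ⊂ ℤ⁴`, EVERY boundary field `η` and every bounded measurable `F`,
`Var_{γ_V(·|η)}(F) ≤ (2 − 9β_W)⁻¹ ∑_{x ∈ V} ∫ (∫ (F(U) − F(σ))² γ_{x}(dσ|U)) γ_V(dU|η)` — the finite-volume heat-bath dynamics of strong-coupling
4D `SU(2)` lattice Yang–Mills has spectral gap `≥ 1 − 9β_W/2` uniformly in the volume AND in the boundary condition. [folklore] -/
theorem su2_kernelVariance_le {βW : ℝ} (h0 : 0 ≤ βW) (h : βW < 2 / 9) {V : Finset (ZdEdge 4)} (hV : V.Nonempty)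
    (η : LGConfig 4 (Matrix.specialUnitaryGroup (Fin 2) ℂ)) {F : LGConfig 4 (Matrix.specialUnitaryGroup (Fin 2) ℂ) → ℝ}
    (hF : Measurable F) (hFb : ∃ M : ℝ, ∀ U, |F U| ≤ M) :
    ProbabilityTheory.variance F (ymSpecification (fundamentalRep (Fin 2)) (βW / 2) V η) ≤
      (2 - 9 * βW)⁻¹ * ∑ x ∈ V, ∫ U, ∫ σ, (F U - F σ) ^ 2 ∂(ymSpecification (fundamentalRep (Fin 2)) (βW / 2) {x} U)
        ∂(ymSpecification (fundamentalRep (Fin 2)) (βW / 2) V η) := by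
  have hβ : ((2 : ℕ) : ℝ) * (βW / 4) = βW / 2 := by push_cast; ring
  have habs : |βW / 4| = βW / 4 := abs_of_nonneg (by positivity)
  have key := kernelVariance_le_of_oneLinkKRModulus (d := 4) (N := 2) (by norm_num) (by norm_num) (β := βW / 4) (R := 3 * βW / 2)
    zero_le_one (by rw [habs]; norm_num; linarith) (SlabAreaLawDimensions.su2_oneLinkKRModulus_of_le_one (by linarith)) (c := 9 * βW / 2)
    (by rw [habs]; norm_num; linarith) (by linarith) hV η hF hFb
  have e : (2 * (1 - 9 * βW / 2))⁻¹ = (2 - 9 * βW)⁻¹ := by congr 1; ring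
  rw [hβ, e] at key
  exact key

end Kernel

end Summit.Ventures.YMGap.RobustBall.HeatBathPoincareZd

end
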